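import Mathlib

/-!
# SoloBlindSignPattern — sign-pattern rigidity of Frobenius polynomials

Solo seat `solo-Langlands-blind` (blind mode), session 6.  Pure commutative algebra over a field `K`
with `2 ≠ 0`; it is the finite step (a)/(c) in the proof of Theorem B̃ of this seat's dihedral
descent (paper/dihedral-descent.md §5.4): along the `S₃`-resolvent, the twisted identities
`(*_μ)` compare, at a Frobenius element, the product of the three *sign-twisted* characteristic
polynomials `X² - e_i T_i X + D_i` of the conjugates of the phantom representation with the product
of the three sign-twisted Hecke polynomials `X² - e_i t_i X + d` (common constant term `d = q^m`,
i.e. trivial central character), for every sign vector `e` realised by a quadratic Hecke character.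

* `quad_prod_signPattern` (split-completely places): if the identity holds for the four sign vectors
  `(1,1,1), (-1,1,1), (1,-1,1), (1,1,-1)` then `T_i = t_i` and `D_i = d` for every `i`.
* `quad_prod_signPattern_reflection` (reflection-type places, where the last two factors coincide and
  only the sign vectors `(1,e,e)` are realised): if
  `p₀ · (p₁^{e})² = q₀ · (q₁^{e})²` for `e = ±1` then again `T_i = t_i`, `D_i = d`.

The common constant term is necessary: with `T₀ = T₁ = t₀ = t₁ = 0` the hypothesis only sees the
multiset `{D₀, D₁}`.  No number theory is used; the statements are the exact algebra invoked there.
-/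

namespace Summit.Langlands.Langlands.Theorems
namespace SoloBlind

open Polynomial

section SignPattern

variable {K : Type*} [Field K]

/-- The monic quadratic `X² - a X + b`. -/
noncomputable def quad (a b : K) : K[X] := X ^ 2 - C a * X + C b

/-- A monic sextic in alternating-sign normal form. -/
noncomputable def sextic (c₅ c₄ c₃ c₂ c₁ c₀ : K) : K[X] :=
  X ^ 6 - C c₅ * X ^ 5 + C c₄ * X ^ 4 - C c₃ * X ^ 3 + C c₂ * X ^ 2 - C c₁ * X + C c₀

/-- The product of three monic quadratics `X² - a_i X + b_i`, written in sextic normal form with the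
elementary expressions in the `a_i, b_i` as coefficients. -/
theorem quad_mul_quad_mul_quad (a₀ b₀ a₁ b₁ a₂ b₂ : K) :
    quad a₀ b₀ * quad a₁ b₁ * quad a₂ b₂ =
      sextic (a₀ + a₁ + a₂)
        (b₀ + b₁ + b₂ + (a₀ * a₁ + a₀ * a₂ + a₁ * a₂))
        (a₀ * a₁ * a₂ + (a₀ * (b₁ + b₂) + a₁ * (b₀ + b₂) + a₂ * (b₀ + b₁)))
        (b₀ * b₁ + b₀ * b₂ + b₁ * b₂ + (a₀ * a₁ * b₂ + a₀ * a₂ * b₁ + a₁ * a₂ * b₀))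
        (a₀ * b₁ * b₂ + a₁ * b₀ * b₂ + a₂ * b₀ * b₁)
        (b₀ * b₁ * b₂) := by
  simp only [quad, sextic, map_add, map_mul]
  ring

/-- Two sextics in normal form are equal only if all six coefficients agree. -/
theorem sextic_injective {c₅ c₄ c₃ c₂ c₁ c₀ c₅' c₄' c₃' c₂' c₁' c₀' : K}
    (h : sextic c₅ c₄ c₃ c₂ c₁ c₀ = sextic c₅' c₄' c₃' c₂' c₁' c₀') :
    c₅ = c₅' ∧ c₄ = c₄' ∧ c₃ = c₃' ∧ c₂ = c₂' ∧ c₁ = c₁' ∧ c₀ = c₀' := by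
  have h5 := congrArg (fun p : K[X] => p.coeff 5) h
  have h4 := congrArg (fun p : K[X] => p.coeff 4) h
  have h3 := congrArg (fun p : K[X] => p.coeff 3) h
  have h2 := congrArg (fun p : K[X] => p.coeff 2) h
  have h1 := congrArg (fun p : K[X] => p.coeff 1) h
  have h0 := congrArg (fun p : K[X] => p.coeff 0) h
  simp only [sextic, coeff_add, coeff_sub, coeff_C_mul, coeff_X_pow, coeff_C, coeff_X]
    at h5 h4 h3 h2 h1 h0
  norm_num at h5 h4 h3 h2 h1 h0
  exact ⟨h5, h4, h3, h2, h1, h0⟩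

/-- If the elementary symmetric functions of `(D₀, D₁, D₂)` are those of `(d, d, d)` then every
`D_i` equals `d` (each `D_i` is a root of `(X - d)³`). -/
theorem eq_of_esymm_eq_triple {D₀ D₁ D₂ d : K} (h₁ : D₀ + D₁ + D₂ = 3 * d)
    (h₂ : D₀ * D₁ + D₀ * D₂ + D₁ * D₂ = 3 * d ^ 2) (h₃ : D₀ * D₁ * D₂ = d ^ 3) :
    D₀ = d ∧ D₁ = d ∧ D₂ = d := by
  have e₀ : (D₀ - d) ^ 3 = 0 := by linear_combination D₀ ^ 2 * h₁ - D₀ * h₂ + h₃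
  have e₁ : (D₁ - d) ^ 3 = 0 := by linear_combination D₁ ^ 2 * h₁ - D₁ * h₂ + h₃
  have e₂ : (D₂ - d) ^ 3 = 0 := by linear_combination D₂ ^ 2 * h₁ - D₂ * h₂ + h₃
  refine ⟨?_, ?_, ?_⟩
  · exact sub_eq_zero.mp (pow_eq_zero_iff (three_ne_zero) |>.mp e₀)
  · exact sub_eq_zero.mp (pow_eq_zero_iff (three_ne_zero) |>.mp e₁)
  · exact sub_eq_zero.mp (pow_eq_zero_iff (three_ne_zero) |>.mp e₂)

/-- **Sign-pattern rigidity, split-completely places.**  Over a field with `2 ≠ 0`: if the product of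
the three sign-twisted quadratics `X² - e_i T_i X + D_i` equals the product of the sign-twisted
`X² - e_i t_i X + d` for the sign vectors `(1,1,1)`, `(-1,1,1)`, `(1,-1,1)`, `(1,1,-1)`, then
`T_i = t_i` and `D_i = d` for all `i`. -/
theorem quad_prod_signPattern (h2 : (2 : K) ≠ 0) {T₀ T₁ T₂ D₀ D₁ D₂ t₀ t₁ t₂ d : K}
    (h : ∀ e₀ e₁ e₂ : K, (e₀ = 1 ∧ e₁ = 1 ∧ e₂ = 1) ∨ (e₀ = -1 ∧ e₁ = 1 ∧ e₂ = 1) ∨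
        (e₀ = 1 ∧ e₁ = -1 ∧ e₂ = 1) ∨ (e₀ = 1 ∧ e₁ = 1 ∧ e₂ = -1) →
      quad (e₀ * T₀) D₀ * quad (e₁ * T₁) D₁ * quad (e₂ * T₂) D₂ =
        quad (e₀ * t₀) d * quad (e₁ * t₁) d * quad (e₂ * t₂) d) :
    T₀ = t₀ ∧ T₁ = t₁ ∧ T₂ = t₂ ∧ D₀ = d ∧ D₁ = d ∧ D₂ = d := by
  have H := fun (e₀ e₁ e₂ : K) (he : (e₀ = 1 ∧ e₁ = 1 ∧ e₂ = 1) ∨ (e₀ = -1 ∧ e₁ = 1 ∧ e₂ = 1) ∨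
      (e₀ = 1 ∧ e₁ = -1 ∧ e₂ = 1) ∨ (e₀ = 1 ∧ e₁ = 1 ∧ e₂ = -1)) =>
    sextic_injective
      (((quad_mul_quad_mul_quad (e₀ * T₀) D₀ (e₁ * T₁) D₁ (e₂ * T₂) D₂).symm.trans
        (h e₀ e₁ e₂ he)).trans (quad_mul_quad_mul_quad (e₀ * t₀) d (e₁ * t₁) d (e₂ * t₂) d))
  obtain ⟨a5, a4, -, a2, -, a0⟩ := H 1 1 1 (Or.inl ⟨rfl, rfl, rfl⟩)
  obtain ⟨b5, -, -, b2, -, -⟩ := H (-1) 1 1 (Or.inr (Or.inl ⟨rfl, rfl, rfl⟩))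
  obtain ⟨c5, -, -, c2, -, -⟩ := H 1 (-1) 1 (Or.inr (Or.inr (Or.inl ⟨rfl, rfl, rfl⟩)))
  obtain ⟨d5, -, -, d2, -, -⟩ := H 1 1 (-1) (Or.inr (Or.inr (Or.inr ⟨rfl, rfl, rfl⟩)))
  -- cancelling the unit `2`
  have cancel2 : ∀ {x : K}, (2 : K) * x = 0 → x = 0 := fun hx =>
    (mul_eq_zero.mp hx).resolve_left h2
  -- traces (coefficient of `X⁵`)
  have hT₀ : T₀ = t₀ := by
    have h' : (2 : K) * (T₀ - t₀) = 0 := by linear_combination a5 - b5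
    exact sub_eq_zero.mp (cancel2 h')
  have hT₁ : T₁ = t₁ := by
    have h' : (2 : K) * (T₁ - t₁) = 0 := by linear_combination a5 - c5
    exact sub_eq_zero.mp (cancel2 h')
  have hT₂ : T₂ = t₂ := by
    have h' : (2 : K) * (T₂ - t₂) = 0 := by linear_combination a5 - d5
    exact sub_eq_zero.mp (cancel2 h')
  rw [← hT₀, ← hT₁, ← hT₂] at a4 a2 b2 c2 d2
  -- elementary symmetric functions of the constant terms (coefficients of `X⁴`, `X⁰`)
  have s₁ : D₀ + D₁ + D₂ = 3 * d := by linear_combination a4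
  have s₃ : D₀ * D₁ * D₂ = d ^ 3 := by linear_combination a0
  -- coefficient of `X²`: the mixed terms `T_i T_j (D_k - d)` vanish pairwise, hence singly
  have m₀ : T₀ * T₁ * (D₂ - d) + T₀ * T₂ * (D₁ - d) = 0 :=
    cancel2 (by linear_combination a2 - b2)
  have m₁ : T₀ * T₁ * (D₂ - d) + T₁ * T₂ * (D₀ - d) = 0 :=
    cancel2 (by linear_combination a2 - c2)
  have m₂ : T₀ * T₂ * (D₁ - d) + T₁ * T₂ * (D₀ - d) = 0 :=
    cancel2 (by linear_combination a2 - d2)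
  have n₀ : T₁ * T₂ * (D₀ - d) = 0 := cancel2 (by linear_combination m₁ + m₂ - m₀)
  have s₂ : D₀ * D₁ + D₀ * D₂ + D₁ * D₂ = 3 * d ^ 2 := by
    linear_combination a2 - m₀ - n₀
  obtain ⟨hD₀, hD₁, hD₂⟩ := eq_of_esymm_eq_triple s₁ s₂ s₃
  exact ⟨hT₀, hT₁, hT₂, hD₀, hD₁, hD₂⟩

/-- **Sign-pattern rigidity, reflection-type places.**  Here the last two factors coincide
(`p₁ = p₂`, `q₁ = q₂`) and only the sign vectors `(1, e, e)`, `e = ±1`, are realised. -/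
theorem quad_prod_signPattern_reflection (h2 : (2 : K) ≠ 0) {T₀ T₁ D₀ D₁ t₀ t₁ d : K}
    (h : ∀ e : K, e = 1 ∨ e = -1 →
      quad T₀ D₀ * quad (e * T₁) D₁ * quad (e * T₁) D₁ =
        quad t₀ d * quad (e * t₁) d * quad (e * t₁) d) :
    T₀ = t₀ ∧ T₁ = t₁ ∧ D₀ = d ∧ D₁ = d := by
  have H := fun (e : K) (he : e = 1 ∨ e = -1) =>
    sextic_injective
      (((quad_mul_quad_mul_quad T₀ D₀ (e * T₁) D₁ (e * T₁) D₁).symm.trans (h e he)).trans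
        (quad_mul_quad_mul_quad t₀ d (e * t₁) d (e * t₁) d))
  obtain ⟨a5, a4, a3, a2, a1, a0⟩ := H 1 (Or.inl rfl)
  obtain ⟨b5, -, b3, -, b1, -⟩ := H (-1) (Or.inr rfl)
  have h4 : (4 : K) ≠ 0 := by
    have e4 : (4 : K) = 2 * 2 := by norm_num
    rw [e4]; exact mul_ne_zero h2 h2
  have cancel4 : ∀ {x : K}, (4 : K) * x = 0 → x = 0 := fun hx =>
    (mul_eq_zero.mp hx).resolve_left h4
  -- traces (coefficient of `X⁵`)
  have hT₁ : T₁ = t₁ := by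
    have h' : (4 : K) * (T₁ - t₁) = 0 := by linear_combination a5 - b5
    exact sub_eq_zero.mp (cancel4 h')
  have hT₀ : T₀ = t₀ := by linear_combination a5 - 2 * hT₁
  rw [← hT₀, ← hT₁] at a4 a3 a2 a1 b3 b1
  -- coefficients of `X⁴` and `X⁰`
  have s₁ : D₀ + 2 * D₁ = 3 * d := by linear_combination a4
  have s₃ : D₀ * D₁ ^ 2 = d ^ 3 := by linear_combination a0
  -- coefficient of `X³`: the flip gives `T₁ (D₀ + D₁ - 2d) = 0`
  have x3 : T₁ * (D₀ + D₁ - 2 * d) = 0 := cancel4 (by linear_combination a3 - b3)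
  -- coefficient of `X¹`: the flip gives `T₁ (D₀ D₁ - d²) = 0`
  have x1 : T₁ * (D₀ * D₁ - d ^ 2) = 0 := cancel4 (by linear_combination a1 - b1)
  by_cases ht : T₁ = 0
  · -- then the coefficient of `X²` gives the second symmetric function directly
    have s₂ : 2 * (D₀ * D₁) + D₁ ^ 2 = 3 * d ^ 2 := by
      linear_combination a2 - (2 * T₀ * (D₁ - d) + T₁ * (D₀ - d)) * ht
    obtain ⟨hD₀, hD₁, -⟩ := eq_of_esymm_eq_triple (D₀ := D₀) (D₁ := D₁) (D₂ := D₁) (d := d)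
      (by linear_combination s₁) (by linear_combination s₂) (by linear_combination s₃)
    exact ⟨hT₀, hT₁, hD₀, hD₁⟩
  · have u : D₀ + D₁ - 2 * d = 0 := (mul_eq_zero.mp x3).resolve_left ht
    have v : D₀ * D₁ - d ^ 2 = 0 := (mul_eq_zero.mp x1).resolve_left ht
    have hD₁ : D₁ = d := by
      have hsq : (D₁ - d) ^ 2 = 0 := by linear_combination D₁ * u - v
      exact sub_eq_zero.mp (pow_eq_zero_iff two_ne_zero |>.mp hsq)
    have hD₀ : D₀ = d := by linear_combination u - hD₁
    exact ⟨hT₀, hT₁, hD₀, hD₁⟩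

end SignPattern

end SoloBlind
end Summit.Langlands.Langlands.Theorems
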